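import Summits.BirchSwinnertonDyer.BirchSwinnertonDyer.Theorems.ByReductionTypeAtTwoTowerLambdaRank
import Summits.BirchSwinnertonDyer.Rank1Residual.X1.GeneratorCountLayer
import Summits.BirchSwinnertonDyer.Rank1Residual.Iwasawa.SelmerCardOfLevelZeroControl
import HarnessLib

/-!
# The TOWER door's RANK certificate read off a finite layer: `2^n ≤ #Sel_{2^∞}(E/ℚ_j)[2]`
# ⇒ `2^n ≤ #X/(2,T^{2^j})X` ⇒ `n ≤ λ(X)` (route ByReductionTypeAtTwo, crux `OrdKatoHalfAtTwo`,
# item stmt-BirchSwinnertonDyer-19271; seat bsd-2adic-tower-1, D-0074 (T1))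

HONEST FRAMING (cell `bsd-2adic`, run/shared/lean/pub/bsd-2adic/, HUMAN RULINGS D-0036/D-0074): THEOREMS
ONLY; nothing asserted; no definition; no new named fact; closes nothing by itself. This file DISCHARGES
the `hrank` input of the TOWER doors of `Theorems/ByReductionTypeAtTwoTowerLambdaRank.lean`
(`…KatoHalfPinch.le_lambda_of_towerGap_of_towerRank`, `…_of_towerGap_of_towerRank`: for every cyclotomic
datum `∃ j, 2^n ≤ #X/(2,T^j)X`) from a FINITE-LAYER datum that a `2`-descent engine computes: a lower
bound `2^n ≤ #Sel_{2^∞}(E/ℚ_j)[2]` for the `2`-torsion of the `2^∞`-Selmer group of `E` over the `j`-th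
layer `ℚ_j` of the cyclotomic `ℤ₂`-extension (`ℚ_1 = ℚ(√2)`, `ℚ_2 = ℚ(ζ₁₆)⁺`, `ℚ_3 = ℚ(ζ₃₂)⁺`), spelled
on the tree's `W.selmerLayer κ j ⊆ H¹(ℚ_j, E[2^∞])` (file `IwasawaSelmer`).

## The mechanism (all PROVED in the tree; this file only composes)

For an elliptic curve `E = W` over a number field `K` with `E(K)[p] = 0`, any `ℤ_p`-extension `κ`, any
`γ`, any Pontryagin-dual datum `D` (`X = D.X` finitely generated) and any layer `n`:
`Sel_{p^∞}(E/K_n) ⊆ A_n = h_n⁻¹(Sel_{p^∞}(E/K_∞))` (`selmerLayer_le_selmerInftyPreimage`, Greenberg's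
map `s_n`), and a finite family of DISTINCT `p`-torsion classes of `A_n` has at most `#(X/I_n X)`
members, `I_n = (p, (1+T)^{pⁿ} − 1) = (p, ω_n)`
(`X1.GeneratorCountLayer.card_le_natCard_quotient_layerIdeal_of_layerClasses`: `h_n` is injective when
`E(K)[p] = 0`, its image is `Γ_n`-fixed, and `I_n X` pairs to zero with `p`-torsion `γ^{pⁿ}`-fixed
classes — the lower half of "`X/(p,ω_n)X` is Pontryagin dual to `Sel_∞[p]^{Γ_n}`", Greenberg §1 p. 60,
§3 pp. 85–86). Finally `(p, ω_n) = (p, T^{pⁿ})` (`X5.TowerGap.span_C_p_sup_span_omega_eq_towerIdeal`).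
Hence **`#Sel_{p^∞}(E/K_n)[p] ≤ #X/(p, T^{pⁿ})X`** (`natCard_selmerLayer_pTorsion_le`, §1, any `p`,
any number field, any `ℤ_p`-extension).

## At `p = 2` over `ℚ` (§2)

* `towerRank_of_layerSelmerTwoTorsion`: `2 ∤ #E(ℚ)_tors` (so `E(ℚ)[2] = 0`,
  `Iwasawa.forall_smul_eq_zero_imp_of_not_dvd_torsionOrder`; automatic when `E[2]` is irreducible)
  and the certificate `2^n ≤ #Sel_{2^∞}(E/ℚ_j)[2]` for every cyclotomic `κ` ⇒ the `hrank` hypothesis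
  of the TOWER doors, with witness `2^j`.
* `le_lambda_of_towerGap_of_layerSelmer`, `mazurMainConjecture_two_of_towerGap_of_layerSelmer`,
  `katoHalfAt_two_of_towerGap_of_layerSelmer`, `bsdp_two_of_towerGap_of_layerSelmer`: the doors of
  the companion file with `hrank` DISCHARGED by the layer certificate — PRINT {Kato 17.4 (1)(2)@2,
  Greenberg Prop. 4.14@2; at rank 0 also Greenberg Thm. 4.1@2, modularity, GZK} + certificates
  {`hper₀`, `TowerGapAtTwo W`, `μ_an = 0`, `λ_an = n`, `2^n ≤ #Sel_{2^∞}(E/ℚ_j)[2]`}.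

READING of the certificate (for the engineer; nothing asserted here): when `E(ℚ_j)[2] = 0` (e.g.
`E[2]` irreducible: a `2`-power extension contains no cubic subfield) the Kummer map identifies
`Sel₂(E/ℚ_j)` with `Sel_{2^∞}(E/ℚ_j)[2]`, so `#Sel_{2^∞}(E/ℚ_j)[2] = 2^{d_j}`, `d_j = dim_{𝔽₂} Sel₂(E/ℚ_j)`
the output of a `2`-descent over the number field `ℚ_j`; `ℚ_j = κ.layer j` is the fixed field of
`κ⁻¹(2^j ℤ₂)`, the unique subfield of degree `2^j` of `ℚ_∞ = ⋃ ℚ(ζ_{2^{m+2}})⁺`.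

References: R. Greenberg, LNM 1716 (1999), §1 p. 60, Thm. 1.2, §3 pp. 85–86, Prop. 4.14; L. Washington,
*Introduction to Cyclotomic Fields*, §13.2; K. Kato, Astérisque 295 (2004), Thm. 17.4.
-/

set_option autoImplicit false

noncomputable section

open scoped Classical MatrixGroups ModularForm

open CongruenceSubgroup WeierstrassCurve Literature.NumberTheory.EllipticCurves
  Literature.NumberTheory.EllipticCurves.ModularForms Literature.NumberTheory.EllipticCurves.Rank1Residual
  Literature.NumberTheory.EllipticCurves.Rank1Residual.Typed
  Literature.NumberTheory.EllipticCurves.Greenberg1999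
  Summit.BirchSwinnertonDyer.Rank1Residual.X1.MuLambda
  Summit.BirchSwinnertonDyer.Rank1Residual.X1.MuPart
  Summit.BirchSwinnertonDyer.Rank1Residual.X1.ParitySqueeze
  Summit.BirchSwinnertonDyer.BirchSwinnertonDyer.Theorems.Rank1ResidualX1Defs
  Summit.BirchSwinnertonDyer.Rank1Residual.X5 Summit.BirchSwinnertonDyer.Rank1Residual.X5.O1
  Summit.BirchSwinnertonDyer.Rank1Residual.X5.TowerGap
  Summit.BirchSwinnertonDyer.Rank1Residual

universe u

namespace Summit.BirchSwinnertonDyer.BirchSwinnertonDyer.Theorems.KatoHalfPinch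

/-! ## §1 `#Sel_{p^∞}(E/K_n)[p] ≤ #X/(p, T^{pⁿ})X` (any `p`, any number field, any `ℤ_p`-extension) -/

section Layer

variable {K : Type u} [Field K] [NumberField K] (W : WeierstrassCurve K) {p : ℕ} [hp : Fact p.Prime]
  (κ : ZpExtension K p) {γ : Field.absoluteGaloisGroup K}

omit [NumberField K] in
/-- `I_n = (p, (1+T)^{pⁿ} − 1) = (p, ω_n) = (p, T^{pⁿ})` as ideals of `Λ = ℤ_p⟦T⟧` (`ω_n ≡ T^{pⁿ} mod p`;
tree `span_C_p_sup_span_omega_eq_towerIdeal`). [cite: Washington1997, §13.2] -/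
theorem layerIdeal_eq_towerIdeal (n : ℕ) :
    Ideal.span {(PowerSeries.C (p : ℤ_[p]) : IwasawaAlgebra p),
        (1 + (PowerSeries.X : IwasawaAlgebra p)) ^ p ^ n - 1} = towerIdeal p (p ^ n) := by
  rw [Ideal.span_insert]
  exact span_C_p_sup_span_omega_eq_towerIdeal p n

/-- **`#Sel_{p^∞}(E/K_n)[p] ≤ #X/(p, T^{pⁿ})X`.** For an elliptic curve `E = W` over a number field `K`
with `E(K)[p] = 0`, any `ℤ_p`-extension `κ`, any `γ ∈ Γ_K`, any Pontryagin-dual datum `D` of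
`Sel_{p^∞}(E/K_∞)` over `(κ, γ)` with `X = D.X` finitely generated over `Λ`, and any layer `n`: the
`p`-torsion classes of `Sel_{p^∞}(E/K_n)` are at most `#X/(p, T^{pⁿ})X` in number (and finitely many).
They lie in `A_n = h_n⁻¹(Sel_∞)` (`selmerLayer_le_selmerInftyPreimage`), distinct `p`-torsion classes of
`A_n` are counted by `X/(p, ω_n)X` (`card_le_natCard_quotient_layerIdeal_of_layerClasses`), and
`(p, ω_n) = (p, T^{pⁿ})`. [cite: GreenbergLNM1716, §1 p. 60, Thm. 1.2 and §3 pp. 85–86] -/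
theorem finite_and_natCard_selmerLayer_pTorsion_le [W.IsElliptic] (D : W.SelmerDualData κ γ)
    [Module.Finite (IwasawaAlgebra p) D.X] (hK : ∀ P : W.toAffine.Point, p • P = 0 → P = 0) (n : ℕ) :
    Finite {z : W.selmerLayer κ n // p • z = 0} ∧
      Nat.card {z : W.selmerLayer κ n // p • z = 0} ≤
        Nat.card (D.X ⧸ (towerIdeal p (p ^ n) • ⊤ : Submodule (IwasawaAlgebra p) D.X)) := by
  -- the inclusion `Sel_n[p] ↪ A_n[p]`
  have hle := W.selmerLayer_le_selmerInftyPreimage κ n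
  let f : {z : W.selmerLayer κ n // p • z = 0} → {z : W.selmerInftyPreimage κ n // p • z = 0} :=
    fun z ↦ ⟨AddSubgroup.inclusion hle z.1, by rw [← map_nsmul, z.2, map_zero]⟩
  have hf : Function.Injective f := by
    intro z z' h
    have h' := congrArg (fun w : {z : W.selmerInftyPreimage κ n // p • z = 0} ↦ w.1) h
    exact Subtype.ext (AddSubgroup.inclusion_injective hle h')
  -- every finite family of the target is counted by `X/(p, T^{pⁿ})X`
  have hcount : ∀ t : Finset {z : W.selmerInftyPreimage κ n // p • z = 0},
      t.card ≤ Nat.card (D.X ⧸ (towerIdeal p (p ^ n) • ⊤ : Submodule (IwasawaAlgebra p) D.X)) := by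
    intro t
    rw [← layerIdeal_eq_towerIdeal]
    exact X1.GeneratorCountLayer.card_le_natCard_quotient_layerIdeal_of_layerClasses D hK n t
  -- hence the target, and the source, are finite
  have hfinA : Finite {z : W.selmerInftyPreimage κ n // p • z = 0} := by
    by_contra hinf
    rw [not_finite_iff_infinite] at hinf
    obtain ⟨t, ht⟩ := Infinite.exists_subset_card_eq {z : W.selmerInftyPreimage κ n // p • z = 0}
      (Nat.card (D.X ⧸ (towerIdeal p (p ^ n) • ⊤ : Submodule (IwasawaAlgebra p) D.X)) + 1)
    have := hcount t
    omega
  have hfinS : Finite {z : W.selmerLayer κ n // p • z = 0} := Finite.of_injective f hf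
  refine ⟨hfinS, ?_⟩
  haveI := Fintype.ofFinite {z : W.selmerLayer κ n // p • z = 0}
  calc Nat.card {z : W.selmerLayer κ n // p • z = 0}
      = (Finset.univ.map ⟨f, hf⟩).card := by rw [Finset.card_map, Finset.card_univ, Nat.card_eq_fintype_card]
    _ ≤ _ := hcount _

end Layer

/-! ## §2 `p = 2`: the layer certificate discharges `hrank`; the doors -/

section Curve

variable (W : WeierstrassCurve ℚ) [W.IsElliptic] [W.IsGloballyMinimal]

omit [W.IsGloballyMinimal] in
/-- **The RANK certificate of the TOWER doors from a finite layer.** `W/ℚ` with ODD torsion order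
(`2 ∤ #E(ℚ)_tors`, so `E(ℚ)[2] = 0`) and, for every cyclotomic `κ`, at least `2^n` two-torsion classes in
`Sel_{2^∞}(E/ℚ_j)` (`hsel`, the layer-`j` certificate). Then for every cyclotomic datum `(κ, γ, D)` there is
a `j'` (namely `2^j`) with `2^n ≤ #X/(2, T^{j'})X` — the hypothesis `hrank` of
`le_lambda_of_towerGap_of_towerRank` and of the doors `…_of_towerGap_of_towerRank`.
[cite: GreenbergLNM1716, §1 p. 60 and §3 pp. 85–86] -/
theorem towerRank_of_layerSelmerTwoTorsion (htors : ¬ 2 ∣ W.torsionOrder) {j n : ℕ}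
    (hsel : ∀ κ : ZpExtension ℚ 2, κ.IsCyclotomic →
      2 ^ n ≤ Nat.card {z : W.selmerLayer κ j // 2 • z = 0}) :
    ∀ (κ : ZpExtension ℚ 2) (γ : Field.absoluteGaloisGroup ℚ), κ.IsCyclotomic →
      κ.IsTopGenerator γ → IsCyclotomicVariable 2 γ → ∀ D : W.SelmerDualData κ γ,
      ∃ j' : ℕ, 2 ^ n ≤ Nat.card (D.X ⧸ (towerIdeal 2 j' • ⊤ : Submodule (IwasawaAlgebra 2) D.X)) := by
  intro κ γ hκ hγ _ D
  haveI : Module.Finite (IwasawaAlgebra 2) D.X := D.module_finite_holds hγ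
  have hK := Iwasawa.forall_smul_eq_zero_imp_of_not_dvd_torsionOrder W htors
  exact ⟨2 ^ j, (hsel κ hκ).trans (finite_and_natCard_selmerLayer_pTorsion_le W κ D hK j).2⟩

/-- **`n ≤ λ(X(E/ℚ_∞))` from two finite-layer certificates**: `TowerGapAtTwo W` (`X` torsion, `μ = 0`)
and `2^n ≤ #Sel_{2^∞}(E/ℚ_j)[2]`, on a curve with odd torsion order, with the PUBLISHED Greenberg
Prop. 4.14@2 (`h414`, no finite submodule). [cite: GreenbergLNM1716, Prop. 4.14 (§4)]
[cite: Washington1997, §13.2] -/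
theorem le_lambda_of_towerGap_of_layerSelmer (h414 : prop414_noFiniteSubmodule_of_not_dvd_torsionOrder)
    (htors : ¬ 2 ∣ W.torsionOrder) (hgap : TowerGapAtTwo W) {j n : ℕ}
    (hsel : ∀ κ : ZpExtension ℚ 2, κ.IsCyclotomic →
      2 ^ n ≤ Nat.card {z : W.selmerLayer κ j // 2 • z = 0})
    (κ : ZpExtension ℚ 2) (γ : Field.absoluteGaloisGroup ℚ) (hκ : κ.IsCyclotomic)
    (hγ : κ.IsTopGenerator γ) (hγ' : IsCyclotomicVariable 2 γ) (D : W.SelmerDualData κ γ) :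
    n ≤ D.lambda :=
  le_lambda_of_towerGap_of_towerRank W h414 htors hgap
    (towerRank_of_layerSelmerTwoTorsion W htors hsel) κ γ hκ hγ hγ' D

/-- **Door (TOWER, layer form): `MazurMainConjecture W 2`** on a good-ordinary-at-`2` curve with odd
torsion order: PRINT {Kato 17.4 (1)(2)@2, Greenberg Prop. 4.14@2} + certificates {`hper₀`,
`TowerGapAtTwo W`, `2^n ≤ #Sel_{2^∞}(E/ℚ_j)[2]`, `μ_an = 0`, `λ_an = n`} — any analytic rank, any
residual image. [cite: Kato2004Asterisque, Thm. 17.4 (1)(2) (p. 273)] [cite: GreenbergLNM1716, Prop. 4.14 (§4)]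
[cite: GreenbergVatsal2000, p. 4 (after Thm. (1.2))] -/
theorem mazurMainConjecture_two_of_towerGap_of_layerSelmer
    (h17 : ∀ [NeZero (W.conductorNorm ℤ)] (f : CuspForm (Gamma0 (W.conductorNorm ℤ)) 2),
      kato_divisibility_allPrimes W 2 (f := f))
    (h414 : prop414_noFiniteSubmodule_of_not_dvd_torsionOrder)
    (hper₀ : ∀ [NeZero (W.conductorNorm ℤ)] (f : CuspForm (Gamma0 (W.conductorNorm ℤ)) 2),
      IsNewformOf W f → ∀ ϖ : ℚ, (ϖ : ℝ) * W.realPeriodRat = plusPeriod f → 0 ≤ padicValRat 2 ϖ)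
    (hgo : GoodOrd W 2) (htors : ¬ 2 ∣ W.torsionOrder) (hgap : TowerGapAtTwo W) {j n : ℕ}
    (hsel : ∀ κ : ZpExtension ℚ 2, κ.IsCyclotomic →
      2 ^ n ≤ Nat.card {z : W.selmerLayer κ j // 2 • z = 0})
    (hlan : AnalyticLambdaEq W 2 n) (hμan : AnalyticMuLE W 2 0) : MazurMainConjecture W 2 :=
  mazurMainConjecture_two_of_towerGap_of_towerRank W h17 h414 hper₀ hgo htors hgap
    (towerRank_of_layerSelmerTwoTorsion W htors hsel) hlan hμan

/-- **The Kato–Néron half (the item `OrdKatoHalfAtTwo` AT `W`), layer form.**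
[cite: Kato2004Asterisque, Thm. 17.4 (1)(2) (p. 273)] [cite: GreenbergLNM1716, Prop. 4.14 (§4)] -/
theorem katoHalfAt_two_of_towerGap_of_layerSelmer
    (h17 : ∀ [NeZero (W.conductorNorm ℤ)] (f : CuspForm (Gamma0 (W.conductorNorm ℤ)) 2),
      kato_divisibility_allPrimes W 2 (f := f))
    (h414 : prop414_noFiniteSubmodule_of_not_dvd_torsionOrder)
    (hper₀ : ∀ [NeZero (W.conductorNorm ℤ)] (f : CuspForm (Gamma0 (W.conductorNorm ℤ)) 2),
      IsNewformOf W f → ∀ ϖ : ℚ, (ϖ : ℝ) * W.realPeriodRat = plusPeriod f → 0 ≤ padicValRat 2 ϖ)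
    (hgo : GoodOrd W 2) (htors : ¬ 2 ∣ W.torsionOrder) (hgap : TowerGapAtTwo W) {j n : ℕ}
    (hsel : ∀ κ : ZpExtension ℚ 2, κ.IsCyclotomic →
      2 ^ n ≤ Nat.card {z : W.selmerLayer κ j // 2 • z = 0})
    (hlan : AnalyticLambdaEq W 2 n) (hμan : AnalyticMuLE W 2 0) :
    MainConjectureLowerDivisibilityAtTwoOrd W :=
  katoHalfAt_two_of_towerGap_of_towerRank W h17 h414 hper₀ hgo htors hgap
    (towerRank_of_layerSelmerTwoTorsion W htors hsel) hlan hμan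

/-- **Door (TOWER, layer form) for `BSD(E,2)` at analytic rank `0`** on a good-ordinary-at-`2` curve with
odd torsion order: PRINT {modularity, GZK, Kato 17.4 (1)(2)@2, Greenberg Thm. 4.1@2 (`hEC`, δ = 0),
Greenberg Prop. 4.14@2} + certificates {`hper₀`, `TowerGapAtTwo W`, `2^n ≤ #Sel_{2^∞}(E/ℚ_j)[2]`,
`μ_an = 0`, `λ_an = n`} ⇒ `BSDp W 2`. [cite: GreenbergLNM1716, Thm. 4.1 (p. 102), Prop. 4.14 (§4)]
[cite: Kato2004Asterisque, Thm. 17.4 (1)(2) (p. 273)] [cite: Miller2011LMS, Def. 1.1] -/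
theorem bsdp_two_of_towerGap_of_layerSelmer (hmod : nonempty_modularParametrizationData)
    (hGZK : rank_eq_analyticRank_of_analyticRank_le_one)
    (h17 : ∀ [NeZero (W.conductorNorm ℤ)] (f : CuspForm (Gamma0 (W.conductorNorm ℤ)) 2),
      kato_divisibility_allPrimes W 2 (f := f))
    (hEC : TwoAdicEulerCharRankZero W 0) (h414 : prop414_noFiniteSubmodule_of_not_dvd_torsionOrder)
    (hper₀ : ∀ [NeZero (W.conductorNorm ℤ)] (f : CuspForm (Gamma0 (W.conductorNorm ℤ)) 2),
      IsNewformOf W f → ∀ ϖ : ℚ, (ϖ : ℝ) * W.realPeriodRat = plusPeriod f → 0 ≤ padicValRat 2 ϖ)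
    (hgo : GoodOrd W 2) (hr : W.analyticRank = 0) (htors : ¬ 2 ∣ W.torsionOrder)
    (hgap : TowerGapAtTwo W) {j n : ℕ}
    (hsel : ∀ κ : ZpExtension ℚ 2, κ.IsCyclotomic →
      2 ^ n ≤ Nat.card {z : W.selmerLayer κ j // 2 • z = 0})
    (hlan : AnalyticLambdaEq W 2 n) (hμan : AnalyticMuLE W 2 0) : BSDp W 2 :=
  bsdp_two_of_towerGap_of_towerRank W hmod hGZK h17 hEC h414 hper₀ hgo hr htors hgap
    (towerRank_of_layerSelmerTwoTorsion W htors hsel) hlan hμan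

end Curve

end Summit.BirchSwinnertonDyer.BirchSwinnertonDyer.Theorems.KatoHalfPinch

end
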